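import Summits.QuantumFields.BalabanUV.Beta.FP.FineSplitJunction
import Summits.QuantumFields.BalabanUV.Beta.FP.KernelReflectionBoundedContact2

/-!
# `BalabanUV.Beta.FP.PerfectAsymptoticsBFCov` — road «FP» for binder row D1, ROW KER-γ, successor item «(α0)-KCOV-RESOCKET» (owner words CLAIMS 2026-08-21
# l.28099, `KER-GAMMA-ALPHA2.md` v1.3 §9): THE γ-END CAPSTONE AT `K := PiBF` WITH THE REFLECTION LETTER (Kcov) ABSTRACT — `hasym_PiBF_of_pieces_of_cov`,
# `hasym_PiBF_of_fineSplit_of_cov` (the tree's `PerfectAsymptoticsBF.hasym_PiBF_of_pieces` ∕ `FineSplitJunction.hasym_PiBF_of_fineSplit` with the CONTACT-FREE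
# bond-reflection laws `hreflP`∕`hreflG` REPLACED by the one letter `hKcov : AxisReflectionCovariant (flipK (PiBF wg wgh V W v w))`) — and ONE NEW SUPPLIER of that
# letter: `axisReflectionCovariant_flipK_PiBF_contact₂`, both sectors reflecting WITH displayed contacts + the consistency identity (R5′
# `KernelReflectionBoundedContact2.axisReflectionCovariant_flip_hessKer_bdd_contact₂` at `N = 1`); the contact-free supplier stays `PerfectPolarizationReflection` ✓

HONEST DEPENDENCY (page 1, mandatory): continuum YM on T⁴ ⇐ BetaPertH ∧ nine spine estimates (0/9 proved); BetaPertH ⇐ (D1) ∧ (D4) ∧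
CAP+tail; G-an2-4 gates asym, D1 and NE2/3/4.  HONEST FRAMING (cell contract, verbatim): «discharging `BetaPertH` makes Bałaban's UV
stability UNCONDITIONAL — a real constructive-QFT result; it is NOT the continuum limit and NOT the Clay problem.»  THIS MODULE is [our object]∕[folklore]
COMPOSITION BY NAME: the bodies of the two tree ENDs verbatim with the (Kcov) line taken as a hypothesis instead of derived from `hreflP`∕`hreflG`;
the supplier is R5′ §4 + `PerfectPolarizationWard.blockCovariant_one`∕`bdd_Pker`∕`bdd_G0ker` + `PerfectPolarizationReflection.axisReflectionCovariant_lincomb`.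
No `def`, no `def … : Prop`, nothing cited, nothing of the manuscripts under audit asserted, 0 sorry; no existing file touched.  WHY ABSTRACT (located,
I-d1leaf02g9-2 ∕ owner l.28099): the level-0 BF data reflect WITH contact (`WilsonReflectionContact.wilsonA_bref`, `SliceVertexReflection.sliceA_bref`, an3
`WilsonJetReflection2.jet22_pull`), so the END's contact-free `hreflP` is unfillable for them; with (Kcov) abstract the END is agnostic to HOW the reflection
letter is supplied (contact-free, R5′'s contact₂, or a later law) — the `sliceW4` instance decides nothing here.  NOT (Kcov) for the literal (its inputs are
H2V-4′'s laws and the W-slot's), NOT hsplit, NOT (ASYMP), NOT D1; 0∕4 row-D1 binders; NOT BetaPertH, NOT continuum, NOT Clay.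

ABSOLUTE RULE (cell charter, verbatim): «No internally-minted statement may enter as a cited fact. Every hypothesis is either kernel-proved in this
package or a verbatim quotation of a PUBLISHED theorem with page reference. The manuscript(s) under audit are NOT citable for their own disputed
steps — they are the thing under adjudication; programme-internal (2001/route/tribunal) claims are never citable.»

CONTENT.
* §1 [folklore]∕[our object] `axisReflectionCovariant_flip_hessKer_one_contact₂` (R5′ §4 at `N = 1` over unit-lattice bi-localised, translation-covariant data),
  **`axisReflectionCovariant_flipK_PiBF_contact₂`** (the (Kcov) letter of `PiBF` from the gluon-sector laws with contacts `CtVα`, `CtWα` against `Pker` and the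
  ghost-sector laws with contacts against `G0ker`, each with its consistency identity `tadpole A (CtWα μ 0 ν z) = Σ three cross bubbles(CtVα)`).
* §2 [our object] **`hasym_PiBF_of_pieces_of_cov`** — `PerfectAsymptoticsBF.hasym_PiBF_of_pieces` with `hKcov` displayed.
* §3 [our object] **`hasym_PiBF_of_fineSplit_of_cov`** — `FineSplitJunction.hasym_PiBF_of_fineSplit` with `hKcov` displayed.
Sequel `FP/FineSplitJunctionLedgerCov.lean`: the bi-vertex ∕ near–far ∕ ledger ENDs with `hKcov` displayed.
Provenance: D1 formalisation swarm LEAF PROVER 01, unit `b2b-balaban-beta-d1-formalise-leaf-01` gen 12, 2026-08-21, road FP row KER-γ (α0)-KCOV-RESOCKET.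
-/

noncomputable section

namespace Summit.QuantumFields.BalabanUV.Beta.FP.PerfectAsymptoticsBFCov

open Finset
open scoped BigOperators
open Literature.MathematicalPhysics.QuantumFieldTheory.Balaban1983to89
open Literature.MathematicalPhysics.QuantumFieldTheory.Balaban1983to89.Beta
open Literature.MathematicalPhysics.QuantumFieldTheory.Balaban1983to89.Beta.BubbleTransfer (c4)
open Literature.MathematicalPhysics.QuantumFieldTheory.Balaban1983to89.B12Normalization (stepBal stepBal_eq)
open B12Sec2to5 (l1)
open PolarizationSign (AxisReflectionCovariant reflSign)
open ExpKernelCalculus (Site MKer BiLoc comp shiftK hessKer tadpole bubble VertexFamily VertexFamily₂)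
open OneStepResolventKernel (Fib LocStencil)
open OneStepKernelFamily (flipK colH)
open KernelWard (Bdd divV divW)
open KernelReflection (LegMap refK bondRefl)
open DyadicShell (Pt supNorm)
open DressedMomentNormalisation (EKer dressedEntry)
open DecimatedMomentSummable (summable_of_absMoment₂)
open LeadingCoefficient (kappaBal)
open Summit.QuantumFields.BalabanUV.Beta.GAN24.CombesThomas (sfStep smStep)
open Summit.QuantumFields.BalabanUV.Beta.D1BFx.MomentTransferPeriodicEntry (EKer₂ dressedEntryP)
open Summit.QuantumFields.BalabanUV.Beta.FP.PerfectObjectsT (KPerf)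
open Summit.QuantumFields.BalabanUV.Beta.FP.TransportInfinityM (colOf)
open Summit.QuantumFields.BalabanUV.Beta.FP.HorizontalBookkeeping (truncK)
open Summit.QuantumFields.BalabanUV.Beta.FP.WilsonCubicGerm (cubicGermOf)
open Summit.QuantumFields.BalabanUV.Beta.FP.GhostCubicGerm (cubicGermOfSc)
open Summit.QuantumFields.BalabanUV.Beta.FP.BubbleGermValue (bfGerm ghostGerm)
open Summit.QuantumFields.BalabanUV.Beta.FP.PerfectPolarization (Pker G0ker PiBF PiBF_def Pker_translate G0ker_translate)
open Summit.QuantumFields.BalabanUV.Beta.FP.PerfectPolarizationWard (bdd_Pker bdd_G0ker blockCovariant_one)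
open Summit.QuantumFields.BalabanUV.Beta.FP.PerfectPolarizationReflection (axisReflectionCovariant_lincomb)
open Summit.QuantumFields.BalabanUV.Beta.FP.PerfectPolarizationGerm (hgerm_PiBF)
open Summit.QuantumFields.BalabanUV.Beta.FP.PerfectPolarizationDecay (sextic_PiBF)
open Summit.QuantumFields.BalabanUV.Beta.FP.PerfectPolarizationZerothMoment (hK0_PiBF)
open Summit.QuantumFields.BalabanUV.Beta.FP.RemainderLedgerCov (hasym_perfect_of_pieces_cov)
open Summit.QuantumFields.BalabanUV.Beta.FP.PerfectBubbleSandwich (entryHyps_perfCol_zero)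
open Summit.QuantumFields.BalabanUV.Beta.FP.FineSplitJunction (hsplit_of_fineSplit)
open Summit.QuantumFields.BalabanUV.Beta.FP.KernelReflectionBoundedContact2 (axisReflectionCovariant_flip_hessKer_bdd_contact₂)

/-! ## §1 The (Kcov) letter of `PiBF` from reflection laws WITH contact -/

section Supplier

variable {Φ : Type*} [Fintype Φ] {A : MKer 4 Φ} {V : Fin 4 → Site 4 → MKer 4 Φ} {W : Fin 4 → Site 4 → Fin 4 → Site 4 → MKer 4 Φ}
  {C Cv Cw Cc Cc₂ δ : ℝ}

/-- [folklore] **ONE SECTOR AT `N = 1`, LAWS WITH CONTACT** (R5′ `axisReflectionCovariant_flip_hessKer_bdd_contact₂` at blocking `1`): bounded translation-invariant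
leg, vertex data bi-localised at the unit-lattice bonds and translation covariant, and for every axis `α` a leg relabelling `Φα` (leaving the leg invariant), an
offset `c`, contact families `CtVα`, `CtWα` (localised) with the two laws and the consistency identity ⟹ `AxisReflectionCovariant (fun μ ν z => hessKer A V W μ ν (−z))`. -/
theorem axisReflectionCovariant_flip_hessKer_one_contact₂ (hAb : Bdd A C) (hA : ∀ t : Site 4, shiftK t A = A)
    (hV : ∀ (μ : Fin 4) (y : Site 4), BiLoc (V μ y) y y Cv δ) (hW : ∀ (μ : Fin 4) (y : Site 4) (ν : Fin 4) (y' : Site 4), BiLoc (W μ y ν y') y y' Cw δ)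
    (hcovV : ∀ (μ : Fin 4) (y t : Site 4), V μ (y + t) = shiftK (-t) (V μ y))
    (hcovW : ∀ (μ : Fin 4) (y : Site 4) (ν : Fin 4) (y' t : Site 4), W μ (y + t) ν (y' + t) = shiftK (-t) (W μ y ν y'))
    (hδ : 0 < δ)
    (hAr : ∀ α : Fin 4, ∃ Φα : LegMap 4 Φ, refK Φα A = A ∧ ∃ c : ℤ, ∃ CtVα : Fin 4 → Site 4 → MKer 4 Φ,
      ∃ CtWα : Fin 4 → Site 4 → Fin 4 → Site 4 → MKer 4 Φ, VertexFamily CtVα 1 Cc δ ∧ VertexFamily₂ CtWα 1 Cc₂ δ ∧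
      (∀ μ y, V μ (bondRefl α c μ y) = reflSign α μ • refK Φα (V μ y + CtVα μ y)) ∧
      (∀ μ y ν y', W μ (bondRefl α c μ y) ν (bondRefl α c ν y') = (reflSign α μ * reflSign α ν) • refK Φα (W μ y ν y' + CtWα μ y ν y')) ∧
      (∀ μ ν z, tadpole A (CtWα μ 0 ν z) =
        bubble A (CtVα μ 0) (V ν z) + bubble A (V μ 0) (CtVα ν z) + bubble A (CtVα μ 0) (CtVα ν z))) :
    AxisReflectionCovariant (fun μ ν z => hessKer A V W μ ν (-z)) := by
  have hV' : VertexFamily V 1 Cv δ := fun μ y => by simpa using hV μ y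
  have hW' : VertexFamily₂ W 1 Cw δ := fun μ y ν y' => by simpa using hW μ y ν y'
  exact axisReflectionCovariant_flip_hessKer_bdd_contact₂ hAb hV' hW' hδ (blockCovariant_one hA hcovV hcovW) hAr

end Supplier

/-- [our object] **`AxisReflectionCovariant (flipK (PiBF wg wgh V W v w))` FROM LAWS WITH CONTACT** — THE (Kcov) LETTER RE-SOCKETED TO R5′: gluon-sector data `(V, W)`
with, per axis, a `Pker`-preserving relabelling, contacts `CtVα`, `CtWα` and the consistency identity against `Pker`; ghost-sector data `(v, w)` likewise against `G0ker`
⟹ the flipped BF perfect polarization is single-axis reflection covariant, for EVERY pair of colour weights (`PerfectPolarizationReflection.axisReflectionCovariant_flipK_PiBF`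
is the case of zero contacts). -/
theorem axisReflectionCovariant_flipK_PiBF_contact₂ (wg wgh : ℝ)
    {V : Fin 4 → Site 4 → MKer 4 (Fib 3)} {W : Fin 4 → Site 4 → Fin 4 → Site 4 → MKer 4 (Fib 3)}
    {v : Fin 4 → Site 4 → MKer 4 Unit} {w : Fin 4 → Site 4 → Fin 4 → Site 4 → MKer 4 Unit} {Cv Cw Cv' Cw' Cc Cc₂ Cc' Cc₂' δ : ℝ} (hδ : 0 < δ)
    (hV : ∀ (μ : Fin 4) (y : Site 4), BiLoc (V μ y) y y Cv δ) (hW : ∀ (μ : Fin 4) (y : Site 4) (ν : Fin 4) (y' : Site 4), BiLoc (W μ y ν y') y y' Cw δ)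
    (hcovV : ∀ (μ : Fin 4) (y t : Site 4), V μ (y + t) = shiftK (-t) (V μ y))
    (hcovW : ∀ (μ : Fin 4) (y : Site 4) (ν : Fin 4) (y' t : Site 4), W μ (y + t) ν (y' + t) = shiftK (-t) (W μ y ν y'))
    (hArP : ∀ α : Fin 4, ∃ Φα : LegMap 4 (Fib 3), refK Φα Pker = Pker ∧ ∃ c : ℤ, ∃ CtVα : Fin 4 → Site 4 → MKer 4 (Fib 3),
      ∃ CtWα : Fin 4 → Site 4 → Fin 4 → Site 4 → MKer 4 (Fib 3), VertexFamily CtVα 1 Cc δ ∧ VertexFamily₂ CtWα 1 Cc₂ δ ∧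
      (∀ μ y, V μ (bondRefl α c μ y) = reflSign α μ • refK Φα (V μ y + CtVα μ y)) ∧
      (∀ μ y ν y', W μ (bondRefl α c μ y) ν (bondRefl α c ν y') = (reflSign α μ * reflSign α ν) • refK Φα (W μ y ν y' + CtWα μ y ν y')) ∧
      (∀ μ ν z, tadpole Pker (CtWα μ 0 ν z) =
        bubble Pker (CtVα μ 0) (V ν z) + bubble Pker (V μ 0) (CtVα ν z) + bubble Pker (CtVα μ 0) (CtVα ν z)))
    (hv : ∀ (μ : Fin 4) (y : Site 4), BiLoc (v μ y) y y Cv' δ) (hw : ∀ (μ : Fin 4) (y : Site 4) (ν : Fin 4) (y' : Site 4), BiLoc (w μ y ν y') y y' Cw' δ)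
    (hcovv : ∀ (μ : Fin 4) (y t : Site 4), v μ (y + t) = shiftK (-t) (v μ y))
    (hcovw : ∀ (μ : Fin 4) (y : Site 4) (ν : Fin 4) (y' t : Site 4), w μ (y + t) ν (y' + t) = shiftK (-t) (w μ y ν y'))
    (hArG : ∀ α : Fin 4, ∃ Ψα : LegMap 4 Unit, refK Ψα G0ker = G0ker ∧ ∃ c : ℤ, ∃ Ctvα : Fin 4 → Site 4 → MKer 4 Unit,
      ∃ Ctwα : Fin 4 → Site 4 → Fin 4 → Site 4 → MKer 4 Unit, VertexFamily Ctvα 1 Cc' δ ∧ VertexFamily₂ Ctwα 1 Cc₂' δ ∧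
      (∀ μ y, v μ (bondRefl α c μ y) = reflSign α μ • refK Ψα (v μ y + Ctvα μ y)) ∧
      (∀ μ y ν y', w μ (bondRefl α c μ y) ν (bondRefl α c ν y') = (reflSign α μ * reflSign α ν) • refK Ψα (w μ y ν y' + Ctwα μ y ν y')) ∧
      (∀ μ ν z, tadpole G0ker (Ctwα μ 0 ν z) =
        bubble G0ker (Ctvα μ 0) (v ν z) + bubble G0ker (v μ 0) (Ctvα ν z) + bubble G0ker (Ctvα μ 0) (Ctvα ν z))) :
    AxisReflectionCovariant (flipK (PiBF wg wgh V W v w)) := by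
  have h1 := axisReflectionCovariant_flip_hessKer_one_contact₂ bdd_Pker Pker_translate hV hW hcovV hcovW hδ hArP
  have h2 := axisReflectionCovariant_flip_hessKer_one_contact₂ bdd_G0ker G0ker_translate hv hw hcovv hcovw hδ hArG
  have h := axisReflectionCovariant_lincomb h1 h2 wg wgh
  have h' : AxisReflectionCovariant (fun μ ν z => PiBF wg wgh V W v w μ ν (-z)) := by simpa only [PiBF_def] using h
  exact h'

/-! ## §2 The γ-END capstone with (Kcov) displayed -/

/-- **(ASYMP) AT THE EXPLICIT KERNEL, MODULO `hsplit`, THE PIECE LEDGER AND THE REFLECTION LETTER** [our object]: VERBATIM `PerfectAsymptoticsBF.hasym_PiBF_of_pieces`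
with the contact-free bond-reflection laws `hreflP`∕`hreflG` REPLACED by the single letter `hKcov : AxisReflectionCovariant (flipK (PiBF wg wgh V W v w))` (supplied by
`PerfectPolarizationReflection.axisReflectionCovariant_flipK_PiBF` for contact-free laws, by §1 for laws with contact); the other three K-letters are discharged as
there ((K6) `sextic_PiBF`, (K0) `hK0_PiBF`, `hgerm_PiBF`). -/
theorem hasym_PiBF_of_pieces_of_cov {Lc : ℕ} [NeZero Lc] (hLc : 2 ≤ Lc) (wg wgh : ℝ)
    {V : Fin 4 → Site 4 → MKer 4 (Fib 3)} {W : Fin 4 → Site 4 → Fin 4 → Site 4 → MKer 4 (Fib 3)}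
    {v : Fin 4 → Site 4 → MKer 4 Unit} {w : Fin 4 → Site 4 → Fin 4 → Site 4 → MKer 4 Unit} {Cv Cw Cx Cw' Cx' CwL CwL' cQ δ : ℝ} (hδ : 0 < δ)
    -- admissible-family letters, gluon sector
    (hV : ∀ (μ : Fin 4) (y : Site 4), BiLoc (V μ y) y y Cv δ) (hW : ∀ (μ : Fin 4) (y : Site 4) (ν : Fin 4) (y' : Site 4), BiLoc (W μ y ν y') y y' Cw δ)
    (hcovV : ∀ (μ : Fin 4) (y t : Site 4), V μ (y + t) = shiftK (-t) (V μ y))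
    (hcovW : ∀ (μ : Fin 4) (y : Site 4) (ν : Fin 4) (y' t : Site 4), W μ (y + t) ν (y' + t) = shiftK (-t) (W μ y ν y'))
    (X : Site 4 → MKer 4 (Fib 3)) (hX : ∀ y, BiLoc (X y) y y Cx δ)
    (hW1 : ∀ y, comp (comp Pker (divV V y)) Pker = comp Pker (X y) - comp (X y) Pker)
    (hW2 : ∀ y ν y', divW W y ν y' = comp (X y) (V ν y') - comp (V ν y') (X y))
    (hKcov : AxisReflectionCovariant (flipK (PiBF wg wgh V W v w)))
    (h0V : ∀ (lam α β : Fin 4), ∑' p : Pt × Pt, V lam 0 p.1 p.2 (Sum.inl α) (Sum.inl β) = 0)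
    (hgermV : cubicGermOf V = cQ • bfGerm)
    (hWloc : ∀ (μ ν : Fin 4) (z : Pt), BiLoc (W μ 0 ν z) 0 z (CwL * Real.exp (-δ * l1 z)) δ)
    -- admissible-family letters, ghost sector
    (hv : ∀ (μ : Fin 4) (y : Site 4), BiLoc (v μ y) y y Cv δ) (hw : ∀ (μ : Fin 4) (y : Site 4) (ν : Fin 4) (y' : Site 4), BiLoc (w μ y ν y') y y' Cw' δ)
    (hcovv : ∀ (μ : Fin 4) (y t : Site 4), v μ (y + t) = shiftK (-t) (v μ y))
    (hcovw : ∀ (μ : Fin 4) (y : Site 4) (ν : Fin 4) (y' t : Site 4), w μ (y + t) ν (y' + t) = shiftK (-t) (w μ y ν y'))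
    (Xg : Site 4 → MKer 4 Unit) (hXg : ∀ y, BiLoc (Xg y) y y Cx' δ)
    (hW1g : ∀ y, comp (comp G0ker (divV v y)) G0ker = comp G0ker (Xg y) - comp (Xg y) G0ker)
    (hW2g : ∀ y ν y', divW w y ν y' = comp (Xg y) (v ν y') - comp (v ν y') (Xg y))
    (h0v : ∀ lam : Fin 4, ∑' p : Pt × Pt, v lam 0 p.1 p.2 () () = 0)
    (hgermv : cubicGermOfSc v = ghostGerm)
    (hwloc : ∀ (μ ν : Fin 4) (z : Pt), BiLoc (w μ 0 ν z) 0 z (CwL' * Real.exp (-δ * l1 z)) δ)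
    -- the colour weights and the entry
    {N : ℝ} (hn : (40 * wg * (1 / 4 : ℝ) * (c4 * cQ) ^ 2 - wgh * (-(1 / 2 : ℝ)) * c4 ^ 2) / 3 = kappaBal N)
    {μ ν : Fin 4} (hμν : μ ≠ ν)
    -- the split against the dressed truncated transport of `PiBF`, and the piece ledger
    {T : ℕ → Fin 4 → Fin 4 → Pt → ℝ} {ι : Type*} (I : Finset ι) {D : ι → ℕ → Pt → ℝ} {B : ι → ℝ}
    (hsplit : ∀ m : ℕ, 1 ≤ m → ∀ u : Pt,
      T m μ ν u - ((Lc ^ m : ℕ) : ℝ) ^ 8 * dressedEntry (colOf (KPerf (d := 3) Lc (sfStep Lc) (smStep 3 Lc) m))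
          (truncK (PiBF wg wgh V W v w) (Lc ^ m)) (((Lc ^ m : ℕ) : ℤ) • u) μ ν = ∑ i ∈ I, D i m u)
    (hpieces : ∀ i ∈ I, ∀ m : ℕ, 1 ≤ m → ∀ S : Finset Pt, ∑ u ∈ S, (supNorm u : ℝ) ^ 2 * |D i m u| ≤ B i) :
    ∃ U₀ : ℝ, 0 ≤ U₀ ∧ ∃ Cg : ℝ, ∀ m : ℕ, 1 ≤ m →
      |B12Beta.secondMoment (T m) μ ν - (m : ℝ) * stepBal N Lc| ≤ (U₀ + ∑ i ∈ I, B i) + Cg := by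
  -- module C's engine shapes of the cubic letters
  have hLoc : LocStencil V Cv δ := fun κ u => hV κ u
  have hcovV0 : ∀ (lam : Fin 4) (u : Site 4), V lam u = shiftK (-u) (V lam 0) := fun lam u => by
    have h := hcovV lam 0 u; rwa [zero_add] at h
  have hcovv0 : ∀ (lam : Fin 4) (u : Site 4), v lam u = shiftK (-u) (v lam 0) := fun lam u => by
    have h := hcovv lam 0 u; rwa [zero_add] at h
  -- the four K-letters at `K := PiBF`
  obtain ⟨C, _, hK⟩ := sextic_PiBF (wg := wg) (wgh := wgh) (cQ := cQ) hδ hLoc hcovV0 h0V hgermV hWloc hv hcovv0 h0v hgermv hwloc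
  have hK0 : ∀ c e, HasSum (PiBF wg wgh V W v w c e) 0 :=
    hK0_PiBF wg wgh hδ hV hW hcovV hcovW X hX hW1 hW2 hv hw hcovv hcovw Xg hXg hW1g hW2g h0V hgermV hWloc h0v hgermv hwloc
  obtain ⟨Cg, hgerm⟩ := hgerm_PiBF (wg := wg) (wgh := wgh) (cQ := cQ) hδ hLoc hcovV0 h0V hgermV hWloc hv hcovv0 h0v hgermv hwloc hn hμν
  -- the cov re-cut END
  obtain ⟨U₀, hU₀, hasym⟩ := hasym_perfect_of_pieces_cov hLc hK hKcov hK0 (T := T) μ ν I hsplit hpieces hgerm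
  refine ⟨U₀, hU₀, Cg, fun m hm => ?_⟩
  have h := hasym m hm
  rw [stepBal_eq]
  simpa using h

/-! ## §3 The fine-split twin with (Kcov) displayed -/

section FineSplit

variable {Lc : ℕ} [NeZero Lc]

/-- **(ASYMP) MODULO A FINE SPLIT, THE PIECE LEDGER AND THE REFLECTION LETTER** [our object]: VERBATIM `FineSplitJunction.hasym_PiBF_of_fineSplit` with `hreflP`∕`hreflG`
REPLACED by `hKcov`. -/
theorem hasym_PiBF_of_fineSplit_of_cov (hLc : 2 ≤ Lc) (wg wgh : ℝ)
    {V : Fin 4 → Site 4 → MKer 4 (Fib 3)} {W : Fin 4 → Site 4 → Fin 4 → Site 4 → MKer 4 (Fib 3)}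
    {v : Fin 4 → Site 4 → MKer 4 Unit} {w : Fin 4 → Site 4 → Fin 4 → Site 4 → MKer 4 Unit} {Cv Cw Cx Cw' Cx' CwL CwL' cQ δ : ℝ} (hδ : 0 < δ)
    -- admissible-family letters, gluon sector
    (hV : ∀ (μ : Fin 4) (y : Site 4), BiLoc (V μ y) y y Cv δ) (hW : ∀ (μ : Fin 4) (y : Site 4) (ν : Fin 4) (y' : Site 4), BiLoc (W μ y ν y') y y' Cw δ)
    (hcovV : ∀ (μ : Fin 4) (y t : Site 4), V μ (y + t) = shiftK (-t) (V μ y))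
    (hcovW : ∀ (μ : Fin 4) (y : Site 4) (ν : Fin 4) (y' t : Site 4), W μ (y + t) ν (y' + t) = shiftK (-t) (W μ y ν y'))
    (X : Site 4 → MKer 4 (Fib 3)) (hX : ∀ y, BiLoc (X y) y y Cx δ)
    (hW1 : ∀ y, comp (comp Pker (divV V y)) Pker = comp Pker (X y) - comp (X y) Pker)
    (hW2 : ∀ y ν y', divW W y ν y' = comp (X y) (V ν y') - comp (V ν y') (X y))
    (hKcov : AxisReflectionCovariant (flipK (PiBF wg wgh V W v w)))
    (h0V : ∀ (lam α β : Fin 4), ∑' p : Pt × Pt, V lam 0 p.1 p.2 (Sum.inl α) (Sum.inl β) = 0)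
    (hgermV : cubicGermOf V = cQ • bfGerm)
    (hWloc : ∀ (μ ν : Fin 4) (z : Pt), BiLoc (W μ 0 ν z) 0 z (CwL * Real.exp (-δ * l1 z)) δ)
    -- admissible-family letters, ghost sector
    (hv : ∀ (μ : Fin 4) (y : Site 4), BiLoc (v μ y) y y Cv δ) (hw : ∀ (μ : Fin 4) (y : Site 4) (ν : Fin 4) (y' : Site 4), BiLoc (w μ y ν y') y y' Cw' δ)
    (hcovv : ∀ (μ : Fin 4) (y t : Site 4), v μ (y + t) = shiftK (-t) (v μ y))
    (hcovw : ∀ (μ : Fin 4) (y : Site 4) (ν : Fin 4) (y' t : Site 4), w μ (y + t) ν (y' + t) = shiftK (-t) (w μ y ν y'))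
    (Xg : Site 4 → MKer 4 Unit) (hXg : ∀ y, BiLoc (Xg y) y y Cx' δ)
    (hW1g : ∀ y, comp (comp G0ker (divV v y)) G0ker = comp G0ker (Xg y) - comp (Xg y) G0ker)
    (hW2g : ∀ y ν y', divW w y ν y' = comp (Xg y) (v ν y') - comp (v ν y') (Xg y))
    (h0v : ∀ lam : Fin 4, ∑' p : Pt × Pt, v lam 0 p.1 p.2 () () = 0)
    (hgermv : cubicGermOfSc v = ghostGerm)
    (hwloc : ∀ (μ ν : Fin 4) (z : Pt), BiLoc (w μ 0 ν z) 0 z (CwL' * Real.exp (-δ * l1 z)) δ)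
    -- the colour weights and the entry
    {N : ℝ} (hn : (40 * wg * (1 / 4 : ℝ) * (c4 * cQ) ^ 2 - wgh * (-(1 / 2 : ℝ)) * c4 ^ 2) / 3 = kappaBal N)
    {μ ν : Fin 4} (hμν : μ ≠ ν)
    -- the sandwich form of the coarse tables, the FINE split against the transported `PiBF`, bounded pieces, and the piece ledger
    {T : ℕ → Fin 4 → Fin 4 → Pt → ℝ} {F : ℕ → EKer₂ 4} {ι : Type*} (I : Finset ι) {G : ι → ℕ → EKer₂ 4} {B : ι → ℝ}
    (hsand : ∀ m : ℕ, 1 ≤ m → ∀ u : Pt,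
      T m μ ν u = dressedEntryP (fun c a => colH (KPerf (d := 3) Lc (sfStep Lc) (smStep 3 Lc) m) (Lc ^ m) a 0 c) (F m)
        (((Lc ^ m : ℕ) : ℤ) • (-u)) μ ν)
    (hfine : ∀ m : ℕ, 1 ≤ m → ∀ (c e : Fin 4) (s s' : Pt),
      F m c e s s' - ((Lc ^ m : ℕ) : ℝ) ^ 8 * truncK (PiBF wg wgh V W v w) (Lc ^ m) c e (s' - s) = ∑ i ∈ I, G i m c e s s')
    (hGb : ∀ i ∈ I, ∀ m : ℕ, 1 ≤ m → ∀ c e : Fin 4, ∃ A, ∀ s s', |G i m c e s s'| ≤ A)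
    (hpieces : ∀ i ∈ I, ∀ m : ℕ, 1 ≤ m → ∀ S : Finset Pt, ∑ u ∈ S, (supNorm u : ℝ) ^ 2 *
      |dressedEntryP (fun c a => colH (KPerf (d := 3) Lc (sfStep Lc) (smStep 3 Lc) m) (Lc ^ m) a 0 c) (G i m)
        (((Lc ^ m : ℕ) : ℤ) • (-u)) μ ν| ≤ B i) :
    ∃ U₀ : ℝ, 0 ≤ U₀ ∧ ∃ Cg : ℝ, ∀ m : ℕ, 1 ≤ m →
      |B12Beta.secondMoment (T m) μ ν - (m : ℝ) * stepBal N Lc| ≤ (U₀ + ∑ i ∈ I, B i) + Cg := by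
  -- (K6) gives a bound of `PiBF`, hence of its truncations
  have hLoc : LocStencil V Cv δ := fun κ u => hV κ u
  have hcovV0 : ∀ (lam : Fin 4) (u : Site 4), V lam u = shiftK (-u) (V lam 0) := fun lam u => by
    have h := hcovV lam 0 u; rwa [zero_add] at h
  have hcovv0 : ∀ (lam : Fin 4) (u : Site 4), v lam u = shiftK (-u) (v lam 0) := fun lam u => by
    have h := hcovv lam 0 u; rwa [zero_add] at h
  obtain ⟨C, hC0, hK⟩ := sextic_PiBF (wg := wg) (wgh := wgh) (cQ := cQ) hδ hLoc hcovV0 h0V hgermV hWloc hv hcovv0 h0v hgermv hwloc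
  have hKf : ∀ c e : Fin 4, ∃ A, ∀ t, |PiBF wg wgh V W v w c e t| ≤ A := fun c e =>
    ⟨C, fun t => (hK c e t).trans (div_le_self hC0 (one_le_pow₀ (by
      have : (0 : ℝ) ≤ (supNorm t : ℝ) := Nat.cast_nonneg _
      linarith)))⟩
  -- the column letter at the perfect resolvent
  have hcol : ∀ m, 1 ≤ m → ∀ κ l : Fin 4, Summable fun u => |colOf (KPerf (d := 3) Lc (sfStep Lc) (smStep 3 Lc) m) κ l u| :=
    fun m hm κ l => (summable_of_absMoment₂ ((entryHyps_perfCol_zero hLc hm).absW κ l)).abs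
  -- the END's `hsplit`, from the fine split
  have hsplit := hsplit_of_fineSplit I (K := fun m => KPerf (d := 3) Lc (sfStep Lc) (smStep 3 Lc) m) (Nb := fun m => Lc ^ m)
    (T := T) (F := F) (G := G) (μ := μ) (ν := ν) hKf hcol hsand hfine hGb
  exact hasym_PiBF_of_pieces_of_cov hLc wg wgh hδ hV hW hcovV hcovW X hX hW1 hW2 hKcov h0V hgermV hWloc hv hw hcovv hcovw Xg hXg hW1g hW2g
    h0v hgermv hwloc hn hμν I hsplit hpieces

end FineSplit

end Summit.QuantumFields.BalabanUV.Beta.FP.PerfectAsymptoticsBFCov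

end
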